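import Summits.BirchSwinnertonDyer.BirchSwinnertonDyer.Theorems.Rank1ResidualX9Defs
import Literature.NumberTheory.EllipticCurves.TateModuleTransvectionDetFormProofs
import Literature.NumberTheory.EllipticCurves.Rank1Residual.X9SmallImage
import HarnessLib

set_option autoImplicit false

-- the summit and its single problem are both named `BirchSwinnertonDyer` (registry layout D-0017)
set_option linter.dupNamespace false

/-!
# Route `OneSidedTwistSqueezeX9`, crux `KatoDivisibilityX9` (stmt-BirchSwinnertonDyer-20547):
# the Kolyvagin transvection (im), in determinant form, FAILS on all of class X9 — and class X9 is
# exactly the locus `¬(im)` among non-CM good ordinary irreducible primes `p ≥ 5`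

Seat `bsd-line-k6-p4` (D-0154 KEY (146) row 9; lead of LINE A `Cruxes/KatoDivisibilityX9/Lines/conj_a_road.lean`),
cell `bsd-f3-mu`.  OBSTRUCTION-SIDE helper for the crux (`--supports stmt-BirchSwinnertonDyer-20547`):
WHERE the image hypothesis of Road 1 (Kato 2004 Thm. 17.4 (3) / Mazur–Rubin 2004 / Burungale–Castella–
Skinner 2025 Thm. 1.1.2 (b)) enters and why no printed weakening of it reaches the crux's class.  The
cell's IMC lens typed (im) as `KolyvaginTransvection W p := ∃ σ, det ρ_{E,p}(σ) = 1 ∧ T_pE/(ρ(σ)-1)T_pE ≃ ℤ_p`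
and the obstruction `B-imc-im` «`ClassX9 W p → ¬ KolyvaginTransvection W p`» as a CANDIDATE
(`HOME/imc/g15/ImageEntryX9.lean`, evidence #45 on the item; ref1 g15: theorem-grade).  This file proves
both candidate statements UNFOLDED (no new definition) from the Literature theorems of
`TateModuleTransvectionDetFormProofs` (p607982):

* `noKolyvaginTransvection_of_classX9` — at every X9 pair there is no `σ ∈ Γ_ℚ` with
  `det ρ_{E,p}(σ) = 1` and `T_pE/(ρ(σ) - 1)T_pE ≃ ℤ_p` (only `Irr ∧ ¬Surj` of the six X9 conjuncts is used);
* `classX9_iff_noKolyvaginTransvection_of_frame` — for a non-CM curve and a good ordinary irreducible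
  prime `p ≥ 5`, `ClassX9 W p ↔ ¬ (im)`: class X9 is EXACTLY the locus where hypothesis (im) fails.
* `bigIm_iff_exists_det_galoisRepTate_eq_one_quotient_equiv` — the determinant form ↔ the census /
  barrier predicate `Rank1Residual.BigIm` (appended; one notion, two spellings).

So on this crux the Euler-system road survives only through inputs that avoid `τ` altogether (LINE A's
Conjecture A stub; item 19630 `μ_an = 0` via the tree's unconditional core theorem
`X10.coreTheoremAOddPrime_holds`).  Nothing here closes the crux; BSD is not proved by any of this.

References: [BurungaleCastellaSkinner2025] Thm. 1.1.2 (b), hypothesis (im), Rem. 1.1.3 (i), (iii) (p. 2 of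
arXiv:2405.00270v2); [Kato2004Asterisque] Thm. 13.4 (3), (12.5.2), Thm. 17.4 (3); [MazurRubin2004] §3.5;
[Serre1972] §2.4 Prop. 15; [SerreAbelianLadic1968] IV-23 Lemma 3.
-/

noncomputable section

open scoped Classical
open WeierstrassCurve Field Literature.NumberTheory.EllipticCurves
  Summit.BirchSwinnertonDyer.BirchSwinnertonDyer.Rank1Residual

namespace Summit.BirchSwinnertonDyer.BirchSwinnertonDyer.Theorems.OneSidedTwistSqueezeX9KatoDivisibilityX9NoTransvection

variable (W : WeierstrassCurve ℚ) [W.IsElliptic] [W.IsGloballyMinimal] (p : ℕ) [Fact p.Prime]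

/-- **No Kolyvagin transvection on class X9** (`B-imc-im` of cell `bsd-f3-mu`, unfolded): at an X9 pair
(non-CM, `p ≥ 5` good ordinary, `E[p]` irreducible, `ρ̄_{E,p}` not surjective) there is no `σ ∈ Γ_ℚ` with
`det ρ_{E,p}(σ) = 1` and `T_pE/(ρ(σ) - 1)T_pE ≃ ℤ_p`, i.e. hypothesis (im) of BCS 2025 Thm. 1.1.2 (b)
(= Kato 13.4 (3), Mazur–Rubin's `τ`) fails; only `Irr ∧ ¬Surj` is used.
[cite: BurungaleCastellaSkinner2025, hypothesis (im) and Rem. 1.1.3 (iii) (p. 2)] [cite: Serre1972, §2.4 Prop. 15] -/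
theorem noKolyvaginTransvection_of_classX9 (hX9 : ClassX9 W p) :
    ¬ ∃ σ : absoluteGaloisGroup ℚ,
      LinearMap.det (W.galoisRepTate p σ : W.tateModule p →ₗ[ℤ_[p]] W.tateModule p) = 1 ∧
        Nonempty (((W.tateModule p) ⧸ LinearMap.range
          ((W.galoisRepTate p σ : W.tateModule p →ₗ[ℤ_[p]] W.tateModule p) - 1)) ≃ₗ[ℤ_[p]] ℤ_[p]) :=
  W.not_exists_det_galoisRepTate_eq_one_quotient_equiv p hX9.2.2.2.2.1 hX9.2.2.2.2.2

/-- **Class X9 is exactly the locus `¬(im)`** among non-CM curves at good ordinary irreducible primes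
`p ≥ 5` (`SurjectiveIffTransvection` of cell `bsd-f3-mu`, unfolded, in the class's frame): given the
other five conjuncts, `ClassX9 W p` holds iff there is no `σ` with `det ρ_{E,p}(σ) = 1` and
`T_pE/(ρ(σ) - 1)T_pE ≃ ℤ_p`.  (`⟸`: a surjective `ρ̄` at `p ≥ 5` has `(1 1; 0 1)` in its `p`-adic image,
Serre IV-23.)
[cite: BurungaleCastellaSkinner2025, Thm. 1.1.2 (b) and Rem. 1.1.3 (i), (iii) (p. 2)] [cite: SerreAbelianLadic1968, Ch. IV §3.4 Lemma 3 (IV-23)] -/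
theorem classX9_iff_noKolyvaginTransvection_of_frame (hCM : ¬ W.HasCM) (h5 : 5 ≤ p)
    (hgood : W.HasGoodReductionAtPrime p) (hord : ¬ (p : ℤ) ∣ W.frobeniusTrace p)
    (hirr : W.HasIrreducibleModPGaloisRep p) :
    ClassX9 W p ↔
      ¬ ∃ σ : absoluteGaloisGroup ℚ,
        LinearMap.det (W.galoisRepTate p σ : W.tateModule p →ₗ[ℤ_[p]] W.tateModule p) = 1 ∧
          Nonempty (((W.tateModule p) ⧸ LinearMap.range
            ((W.galoisRepTate p σ : W.tateModule p →ₗ[ℤ_[p]] W.tateModule p) - 1)) ≃ₗ[ℤ_[p]] ℤ_[p]) := by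
  constructor
  · exact noKolyvaginTransvection_of_classX9 W p
  · intro h
    refine ⟨hCM, h5, hgood, hord, hirr, fun hsurj => h ?_⟩
    exact W.exists_det_galoisRepTate_eq_one_quotient_equiv_of_surjective p h5 hsurj

/-- **The determinant form IS the tree's (im) predicate `Rank1Residual.BigIm`** (the binder `him` of
the BCS 2025 / Yan–Zhu 2026 facts and the class `KatoBigImageHypothesis` of the barrier
`EulerSystemBigImageAtSmallImage`): `BigIm W p ↔ ∃ σ, det ρ_{E,p}(σ) = 1 ∧ T_pE/(ρ(σ) - 1)T_pE ≃ ℤ_p`.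
So the IMC lens's `KolyvaginTransvection W p` and the census predicate `BigIm W p` are one notion, and
`noKolyvaginTransvection_of_classX9` is `Rank1Residual.ClassX9.not_bigIm` re-spelt (appended 2026-08-28,
same seat; earlier declarations byte-identical).
[cite: BurungaleCastellaSkinner2025, hypothesis (im) (p. 2)] [cite: SilvermanAEC2009, Prop. III.8.1 and Prop. III.8.3] -/
theorem bigIm_iff_exists_det_galoisRepTate_eq_one_quotient_equiv (W : WeierstrassCurve ℚ) [W.IsElliptic]
    (p : ℕ) [Fact p.Prime] :
    Rank1Residual.BigIm W p ↔
      ∃ σ : absoluteGaloisGroup ℚ,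
        LinearMap.det (W.galoisRepTate p σ : W.tateModule p →ₗ[ℤ_[p]] W.tateModule p) = 1 ∧
          Nonempty (((W.tateModule p) ⧸ LinearMap.range
            ((W.galoisRepTate p σ : W.tateModule p →ₗ[ℤ_[p]] W.tateModule p) - 1)) ≃ₗ[ℤ_[p]] ℤ_[p]) := by
  constructor
  · rintro ⟨σ, hσ, hq⟩
    refine ⟨σ, (W.det_galoisRepTate_eq_one_iff_forall_smul_eq_self p σ).mpr ?_, ?_⟩
    · intro n t ht
      rw [absoluteGaloisGroup.smul_def]
      exact hσ t n ht
    · simpa only [Module.End.one_eq_id] using hq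
  · rintro ⟨σ, hdet, hq⟩
    refine ⟨σ, ?_, ?_⟩
    · intro t n ht
      rw [← absoluteGaloisGroup.smul_def]
      exact (W.det_galoisRepTate_eq_one_iff_forall_smul_eq_self p σ).mp hdet n t ht
    · simpa only [Module.End.one_eq_id] using hq

end Summit.BirchSwinnertonDyer.BirchSwinnertonDyer.Theorems.OneSidedTwistSqueezeX9KatoDivisibilityX9NoTransvection

end
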